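import Mathlib
import HarnessLib

/-!
# Property B: 2-colourable families (Lovász's criterion, Erdős's `2^{k-1}` bound, the Erdős–Lovász `k^k` bound, the averaging bound)

S. Jukna, *Extremal Combinatorics — with applications in computer science* (1st ed., Springer 2001)
[Jukna2001], Chapter 6 "Colorings", §6.1 "Property B", Theorems 6.1–6.3, and §6.2.1 "Almost good
colorings", Theorem 6.4, with the proofs printed there.

A *2-colouring* of the points is a map `c : α → Bool`; a set `A` is *monochromatic* under `c` if all
its elements get the same colour (`∀ x ∈ A, ∀ y ∈ A, c x = c y`); a colouring is *legal* for a family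
`𝓕` if no member of `𝓕` is monochromatic, i.e. every member contains two points of different colours
(`∃ x ∈ A, ∃ y ∈ A, c x ≠ c y`), and `𝓕` is *2-colourable* (has *property B*) if a legal 2-colouring
exists. We spell these notions out in the statements (no new definitions).

* `two_colorable_of_card_inter_ne_one` — **Theorem 6.1** (Lovász 1979 [Lovasz2007]): if every member
  has at least two points and `|A ∩ B| ≠ 1` for all `A ≠ B ∈ 𝓕`, then `𝓕` is 2-colourable (greedy
  colouring, as printed). (Jukna omits the harmless proviso `|A| ≥ 2`, without which a family
  containing a singleton is a counterexample.)
* `card_colorings_const_on`, `card_colorings_monochromatic_le` — the count used in the proofs of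
  Theorems 6.2 and 6.4: exactly `2^{n-|A|}` colourings are constantly `b` on `A`, hence at most
  `C(A) = 2 · 2^{n-|A|}` colourings make `A` monochromatic.
* `two_colorable_of_card_lt_two_pow` — **Theorem 6.2** (Erdős 1963b [Erdos1963PropertyB]): a family of
  fewer than `2^{k-1}` sets, each of size at least `k`, is 2-colourable (union bound over the illegal
  colourings, as printed).
* `card_le_pow_self_of_intersecting_of_not_two_colorable`,
  `two_colorable_of_intersecting_of_pow_self_lt_card` — **Theorem 6.3** (Erdős–Lovász 1974
  [ErdosLovasz1975]): a `k`-uniform intersecting family with more than `k^k` members is 2-colourable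
  (the degree sequence `d(B_i) ≥ |𝓕| k^{-i}`, as printed).
* `exists_coloring_few_monochromatic` — **Theorem 6.4**: every `k`-uniform family has a 2-colouring
  under which at most `|𝓕| · 2^{1-k}` members are monochromatic (averaging, as printed).
-/

namespace Literature.Combinatorics.SetFamily

open Finset

variable {α : Type*} [DecidableEq α]

omit [DecidableEq α] in
/-- A set on which a colouring is not constant contains two points of different colours (and
conversely); the trivial dictionary between the two spellings of "not monochromatic".
[cite: Jukna2001, Ch. 6, opening paragraph of the chapter, "a coloring is legal if no member
is monochromatic"] -/
theorem exists_ne_color_of_not_monochromatic {c : α → Bool} {A : Finset α}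
    (h : ¬ ∀ x ∈ A, ∀ y ∈ A, c x = c y) : ∃ x ∈ A, ∃ y ∈ A, c x ≠ c y := by
  by_contra! H
  exact h H

/-- **Theorem 6.1** (Lovász 1979). Let `𝓕` be a family of sets, each with at least two elements, such
that `|A ∩ B| ≠ 1` for any two distinct members `A ≠ B`. Then `𝓕` is 2-colourable: there is a
colouring `c : α → Bool` under which no member of `𝓕` is monochromatic.

Printed proof (greedy): colour the points one by one; if the next point `x` can be coloured neither red
nor blue, there are members `A ∋ x` with `A - {x}` already all red and `B ∋ x` with `B - {x}` all blue,
whence `A ∩ B = {x}`, a contradiction. We run the induction over the finite set of already-coloured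
points, maintaining a colouring under which no member contained in that set is monochromatic.
[cite: Jukna2001, Ch. 6 §6.1, Theorem 6.1 and its proof; Lovasz2007] -/
theorem two_colorable_of_card_inter_ne_one (𝓕 : Finset (Finset α)) (h2 : ∀ A ∈ 𝓕, 2 ≤ A.card)
    (h𝓕 : ∀ A ∈ 𝓕, ∀ B ∈ 𝓕, A ≠ B → (A ∩ B).card ≠ 1) :
    ∃ c : α → Bool, ∀ A ∈ 𝓕, ∃ x ∈ A, ∃ y ∈ A, c x ≠ c y := by
  -- `aux S`: a colouring under which no member of `𝓕` lying inside `S` is monochromatic.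
  have aux : ∀ S : Finset α, ∃ c : α → Bool, ∀ A ∈ 𝓕, A ⊆ S → ∃ x ∈ A, ∃ y ∈ A, c x ≠ c y := by
    intro S
    induction S using Finset.induction_on with
    | empty =>
      refine ⟨fun _ => true, fun A hA hAS => ?_⟩
      have := h2 A hA
      rw [Finset.subset_empty.mp hAS, card_empty] at this
      omega
    | insert a S haS ih =>
      obtain ⟨c, hc⟩ := ih
      by_contra! H
      -- For each colour `b`, colouring `a` with `b` fails: some member through `a`, inside
      -- `insert a S`, has all its other points coloured `b` by `c`.
      have key : ∀ b : Bool, ∃ A ∈ 𝓕, a ∈ A ∧ ∀ x ∈ A, x ≠ a → c x = b := by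
        intro b
        obtain ⟨A, hA, hAS, hmono⟩ := H (fun x => if x = a then b else c x)
        have haA : a ∈ A := by
          by_contra haA
          have hAS' : A ⊆ S := by
            intro x hx
            rcases mem_insert.mp (hAS hx) with rfl | h
            · exact absurd hx haA
            · exact h
          obtain ⟨x, hx, y, hy, hne⟩ := hc A hA hAS'
          have hxa : x ≠ a := by rintro rfl; exact haA hx
          have hya : y ≠ a := by rintro rfl; exact haA hy
          have := hmono x hx y hy
          simp only [hxa, hya, if_false] at this
          exact hne this
        refine ⟨A, hA, haA, fun x hx hxa => ?_⟩
        have := hmono x hx a haA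
        simpa [hxa] using this
      obtain ⟨A, hA, haA, hAt⟩ := key true
      obtain ⟨B, hB, haB, hBf⟩ := key false
      have hAB : A ≠ B := by
        rintro rfl
        have hsub : A ⊆ {a} := by
          intro x hx
          rw [mem_singleton]
          by_contra hxa
          have h1 := hAt x hx hxa
          rw [hBf x hx hxa] at h1
          exact Bool.false_ne_true h1
        have := (card_le_card hsub).trans (card_singleton a).le
        have := h2 A hA
        omega
      have hinter : A ∩ B = {a} := by
        ext x
        simp only [mem_inter, mem_singleton]
        constructor
        · rintro ⟨hxA, hxB⟩
          by_contra hxa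
          have h1 := hAt x hxA hxa
          rw [hBf x hxB hxa] at h1
          exact Bool.false_ne_true h1
        · rintro rfl
          exact ⟨haA, haB⟩
      exact h𝓕 A hA B hB hAB (by rw [hinter, card_singleton])
  obtain ⟨c, hc⟩ := aux (𝓕.biUnion id)
  exact ⟨c, fun A hA => hc A hA (subset_biUnion_of_mem id hA)⟩

/-- **Theorem 6.3** (Erdős–Lovász 1974), bound form. Let `𝓕` be `k`-uniform and intersecting
(`A ∩ B ≠ ∅` for all `A, B ∈ 𝓕`). If `𝓕` is not 2-colourable then `|𝓕| ≤ k^k`.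

Printed proof: with `d(B)` the number of members containing `B`, construct `B_0 = ∅ ⊂ B_1 ⊂ ⋯ ⊂ B_k`,
`|B_i| = i`, with `d(B_i) ≥ |𝓕| · k^{-i}`: given `B_i` (`i < k`), the colouring "`B_i` versus the
rest" is illegal, so some member `E` is monochromatic, and as `|E| = k > i` it must avoid `B_i`; every
member containing `B_i` meets `E`, so some point `x ∈ E` lies in at least `d(B_i)/k` of them, and
`B_{i+1} = B_i ∪ {x}`. Finally `d(B_k) ≤ 1` by uniformity. (Jukna starts at `B_1 = {x_1}` with a
point of maximum degree; starting at `B_0 = ∅` makes that the first instance of the inductive step.)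
[cite: Jukna2001, Ch. 6 §6.1, Theorem 6.3 and its proof; ErdosLovasz1975] -/
theorem card_le_pow_self_of_intersecting_of_not_two_colorable (𝓕 : Finset (Finset α)) (k : ℕ)
    (hk : ∀ A ∈ 𝓕, A.card = k) (hint : ∀ A ∈ 𝓕, ∀ B ∈ 𝓕, (A ∩ B).Nonempty)
    (hno : ∀ c : α → Bool, ∃ A ∈ 𝓕, ∀ x ∈ A, ∀ y ∈ A, c x = c y) :
    𝓕.card ≤ k ^ k := by
  -- the degree sequence
  have claim : ∀ i ≤ k, ∃ B : Finset α, B.card = i ∧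
      𝓕.card ≤ k ^ i * (𝓕.filter fun A => B ⊆ A).card := by
    intro i hi
    induction i with
    | zero => exact ⟨∅, card_empty, by simp⟩
    | succ i ih =>
      obtain ⟨B, hBcard, hBdeg⟩ := ih (by omega)
      -- a monochromatic member `E` for the colouring "`B` versus the rest" must avoid `B`
      obtain ⟨E, hE, hmono⟩ := hno fun x => decide (x ∈ B)
      have hdisj : ∀ x ∈ E, x ∉ B := by
        intro x hx hxB
        have hsub : E ⊆ B := by
          intro y hy
          have := hmono y hy x hx
          simpa [hxB] using this
        have := card_le_card hsub
        rw [hk E hE, hBcard] at this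
        omega
      -- every member containing `B` meets `E`; pigeonhole a point of `E`
      set 𝓕B := 𝓕.filter fun A => B ⊆ A with h𝓕B
      have hcover : 𝓕B ⊆ E.biUnion fun x => 𝓕B.filter fun A => x ∈ A := by
        intro A hA
        have hA𝓕 : A ∈ 𝓕 := (mem_filter.mp hA).1
        obtain ⟨x, hx⟩ := hint E hE A hA𝓕
        rw [mem_biUnion]
        exact ⟨x, (mem_inter.mp hx).1, mem_filter.mpr ⟨hA, (mem_inter.mp hx).2⟩⟩
      have hsum : 𝓕B.card ≤ ∑ x ∈ E, (𝓕B.filter fun A => x ∈ A).card :=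
        (card_le_card hcover).trans card_biUnion_le
      obtain ⟨x, hxE, hx⟩ : ∃ x ∈ E, 𝓕B.card ≤ k * (𝓕B.filter fun A => x ∈ A).card := by
        by_contra! H
        have hEne : E.Nonempty := by
          rw [← card_pos, hk E hE]
          omega
        have hlt := sum_lt_sum_of_nonempty hEne H
        rw [sum_const, hk E hE, smul_eq_mul, ← mul_sum] at hlt
        exact absurd (Nat.mul_le_mul_left k hsum) (not_le.mpr hlt)
      refine ⟨insert x B, by rw [card_insert_of_notMem (hdisj x hxE), hBcard], ?_⟩
      have hfilt : (𝓕B.filter fun A => x ∈ A) = 𝓕.filter fun A => insert x B ⊆ A := by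
        ext A
        simp only [h𝓕B, mem_filter, insert_subset_iff]
        tauto
      calc 𝓕.card ≤ k ^ i * 𝓕B.card := hBdeg
        _ ≤ k ^ i * (k * (𝓕B.filter fun A => x ∈ A).card) := Nat.mul_le_mul_left _ hx
        _ = k ^ (i + 1) * (𝓕.filter fun A => insert x B ⊆ A).card := by
          rw [hfilt, pow_succ, mul_assoc]
  obtain ⟨B, hBcard, hBdeg⟩ := claim k le_rfl
  -- `d(B_k) ≤ 1`: a `k`-set containing the `k`-set `B` equals `B`
  have h1 : (𝓕.filter fun A => B ⊆ A).card ≤ 1 := by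
    rw [card_le_one]
    intro A hA A' hA'
    rw [mem_filter] at hA hA'
    have e1 : B = A := eq_of_subset_of_card_le hA.2 (by rw [hk A hA.1, hBcard])
    have e2 : B = A' := eq_of_subset_of_card_le hA'.2 (by rw [hk A' hA'.1, hBcard])
    rw [← e1, ← e2]
  calc 𝓕.card ≤ k ^ k * (𝓕.filter fun A => B ⊆ A).card := hBdeg
    _ ≤ k ^ k * 1 := Nat.mul_le_mul_left _ h1
    _ = k ^ k := mul_one _

/-- **Theorem 6.3** (Erdős–Lovász 1974). Let `𝓕` be `k`-uniform and intersecting. If `|𝓕| > k^k`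
then `𝓕` is 2-colourable. [cite: Jukna2001, Ch. 6 §6.1, Theorem 6.3; ErdosLovasz1975] -/
theorem two_colorable_of_intersecting_of_pow_self_lt_card (𝓕 : Finset (Finset α)) (k : ℕ)
    (hk : ∀ A ∈ 𝓕, A.card = k) (hint : ∀ A ∈ 𝓕, ∀ B ∈ 𝓕, (A ∩ B).Nonempty)
    (hcard : k ^ k < 𝓕.card) :
    ∃ c : α → Bool, ∀ A ∈ 𝓕, ∃ x ∈ A, ∃ y ∈ A, c x ≠ c y := by
  by_contra! H
  exact absurd (card_le_pow_self_of_intersecting_of_not_two_colorable 𝓕 k hk hint H) (not_le.mpr hcard)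

section Counting

variable [Fintype α]

/-- The number of 2-colourings of an `n`-point set which give all points of `A` the colour `b` is
`2^{n - |A|}` (the colouring is free exactly off `A`). [cite: Jukna2001, Ch. 6 §6.1, proof of
Theorem 6.2 ("`C(A) = 2 · 2^{n-|A|}`"); §6.2.1, proof of Theorem 6.4 ("`|{S : S ⊇ A}|`")] -/
theorem card_colorings_const_on (A : Finset α) (b : Bool) :
    (univ.filter fun c : α → Bool => ∀ x ∈ A, c x = b).card = 2 ^ (Fintype.card α - A.card) := by
  rw [← Fintype.card_subtype]
  let e : {c : α → Bool // ∀ x ∈ A, c x = b} ≃ ({x : α // x ∉ A} → Bool) :=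
    { toFun := fun c x => c.1 x.1
      invFun := fun g => ⟨fun x => if h : x ∈ A then b else g ⟨x, h⟩, fun x hx => by simp [hx]⟩
      left_inv := fun c => by
        apply Subtype.ext
        funext x
        by_cases h : x ∈ A
        · simp [h, c.2 x h]
        · simp [h]
      right_inv := fun g => by
        funext x
        simp [x.2] }
  rw [Fintype.card_congr e, Fintype.card_fun, Fintype.card_bool, Fintype.card_subtype_compl,
    Fintype.card_coe]

/-- At most `C(A) = 2 · 2^{n-|A|}` of the 2-colourings of an `n`-point set make `A` monochromatic
(entirely red or entirely blue). [cite: Jukna2001, Ch. 6 §6.1, proof of Theorem 6.2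
("`C(A) = 2 · 2^{n-|A|}`")] -/
theorem card_colorings_monochromatic_le (A : Finset α) :
    (univ.filter fun c : α → Bool => ∀ x ∈ A, ∀ y ∈ A, c x = c y).card
      ≤ 2 * 2 ^ (Fintype.card α - A.card) := by
  have hsub : (univ.filter fun c : α → Bool => ∀ x ∈ A, ∀ y ∈ A, c x = c y) ⊆
      (univ.filter fun c : α → Bool => ∀ x ∈ A, c x = true) ∪
        (univ.filter fun c : α → Bool => ∀ x ∈ A, c x = false) := by
    intro c hc
    simp only [mem_filter, mem_univ, true_and, mem_union] at hc ⊢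
    rcases A.eq_empty_or_nonempty with hA | ⟨x₀, hx₀⟩
    · left
      simp [hA]
    · cases h : c x₀
      · right
        intro x hx
        rw [hc x hx x₀ hx₀, h]
      · left
        intro x hx
        rw [hc x hx x₀ hx₀, h]
  calc (univ.filter fun c : α → Bool => ∀ x ∈ A, ∀ y ∈ A, c x = c y).card
      ≤ ((univ.filter fun c : α → Bool => ∀ x ∈ A, c x = true) ∪
          (univ.filter fun c : α → Bool => ∀ x ∈ A, c x = false)).card := card_le_card hsub
    _ ≤ (univ.filter fun c : α → Bool => ∀ x ∈ A, c x = true).card +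
          (univ.filter fun c : α → Bool => ∀ x ∈ A, c x = false).card := card_union_le _ _
    _ = 2 * 2 ^ (Fintype.card α - A.card) := by
      rw [card_colorings_const_on, card_colorings_const_on]
      ring

/-- **Theorem 6.2** (Erdős 1963b). Let `𝓕` be a family of sets (of points of an `n`-set), each of size
at least `k`. If `|𝓕| < 2^{k-1}` then `𝓕` is 2-colourable.

Printed proof: the number of illegal colourings is at most `Σ_{A ∈ 𝓕} C(A) ≤ |𝓕| · 2^{n-k+1} < 2^n`,
the total number of colourings, so some colouring is legal.
[cite: Jukna2001, Ch. 6 §6.1, Theorem 6.2 and its proof; Erdos1963PropertyB] -/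
theorem two_colorable_of_card_lt_two_pow (𝓕 : Finset (Finset α)) (k : ℕ)
    (hk : ∀ A ∈ 𝓕, k ≤ A.card) (h𝓕 : 𝓕.card < 2 ^ (k - 1)) :
    ∃ c : α → Bool, ∀ A ∈ 𝓕, ∃ x ∈ A, ∃ y ∈ A, c x ≠ c y := by
  -- degenerate cases `k = 0` and `k > n` (then `𝓕 = ∅`)
  rcases Nat.eq_zero_or_pos k with rfl | hk1
  · have : 𝓕 = ∅ := by
      rw [← card_eq_zero]
      simpa using h𝓕
    exact ⟨fun _ => true, by simp [this]⟩
  by_cases hkn : k ≤ Fintype.card α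
  swap
  · refine ⟨fun _ => true, fun A hA => ?_⟩
    have := (hk A hA).trans (card_le_univ A)
    omega
  -- the illegal colourings
  set bad := (univ.filter fun c : α → Bool => ∃ A ∈ 𝓕, ∀ x ∈ A, ∀ y ∈ A, c x = c y) with hbad
  have hbad_le : bad.card ≤ 𝓕.card * (2 * 2 ^ (Fintype.card α - k)) := by
    calc bad.card
        ≤ (𝓕.biUnion fun A =>
            univ.filter fun c : α → Bool => ∀ x ∈ A, ∀ y ∈ A, c x = c y).card := by
          apply card_le_card
          intro c hc
          simp only [hbad, mem_filter, mem_univ, true_and] at hc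
          simp only [mem_biUnion, mem_filter, mem_univ, true_and]
          exact hc
      _ ≤ ∑ A ∈ 𝓕, (univ.filter fun c : α → Bool => ∀ x ∈ A, ∀ y ∈ A, c x = c y).card :=
          card_biUnion_le
      _ ≤ ∑ A ∈ 𝓕, 2 * 2 ^ (Fintype.card α - k) := by
          refine sum_le_sum fun A hA => (card_colorings_monochromatic_le A).trans ?_
          apply Nat.mul_le_mul_left
          apply Nat.pow_le_pow_right (by norm_num)
          have := hk A hA
          omega
      _ = 𝓕.card * (2 * 2 ^ (Fintype.card α - k)) := by rw [sum_const, smul_eq_mul]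
  have hlt : bad.card < (univ : Finset (α → Bool)).card := by
    rw [card_univ, Fintype.card_fun, Fintype.card_bool]
    calc bad.card ≤ 𝓕.card * (2 * 2 ^ (Fintype.card α - k)) := hbad_le
      _ < 2 ^ (k - 1) * (2 * 2 ^ (Fintype.card α - k)) :=
          Nat.mul_lt_mul_of_pos_right h𝓕 (by positivity)
      _ = 2 ^ Fintype.card α := by
          rw [← pow_succ', ← pow_add]
          congr 1
          omega
  obtain ⟨c, -, hc⟩ := exists_mem_notMem_of_card_lt_card hlt
  refine ⟨c, fun A hA => exists_ne_color_of_not_monochromatic fun hmono => hc ?_⟩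
  simp only [hbad, mem_filter, mem_univ, true_and]
  exact ⟨A, hA, hmono⟩

/-- **Theorem 6.4** (almost good colourings). For every `k`-uniform family `𝓕` there is a
2-colouring of its points which colours at most `|𝓕| · 2^{1-k}` of the sets of `𝓕` monochromatically;
in integers: `2^{k-1} · #{monochromatic members} ≤ |𝓕|`.

Printed proof (averaging): summing the number `M(c)` of monochromatic members over all `2^n`
colourings gives `Σ_c M(c) = Σ_{A ∈ 𝓕} C(A) = |𝓕| · 2^{n-k+1}`, so some `c` has
`M(c) ≤ |𝓕| · 2^{1-k}`. [cite: Jukna2001, Ch. 6 §6.2.1, Theorem 6.4 and its proof] -/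
theorem exists_coloring_few_monochromatic (𝓕 : Finset (Finset α)) (k : ℕ)
    (hk : ∀ A ∈ 𝓕, A.card = k) :
    ∃ c : α → Bool,
      2 ^ (k - 1) * (𝓕.filter fun A => ∀ x ∈ A, ∀ y ∈ A, c x = c y).card ≤ 𝓕.card := by
  -- degenerate cases `k = 0` and `k > n` (then `𝓕 = ∅`)
  rcases Nat.eq_zero_or_pos k with rfl | hk1
  · refine ⟨fun _ => true, ?_⟩
    rw [Nat.zero_sub, pow_zero, one_mul]
    exact card_filter_le _ _
  by_cases hkn : k ≤ Fintype.card α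
  swap
  · refine ⟨fun _ => true, ?_⟩
    have : 𝓕 = ∅ := by
      refine eq_empty_of_forall_notMem fun A hA => ?_
      have := (hk A hA).symm.le.trans (card_le_univ A)
      omega
    simp [this]
  -- the double count `Σ_c M(c) = Σ_A C(A) ≤ |𝓕| · 2 · 2^{n-k}`
  set M : (α → Bool) → ℕ := fun c => (𝓕.filter fun A => ∀ x ∈ A, ∀ y ∈ A, c x = c y).card
    with hM
  have hsum : ∑ c, M c ≤ 𝓕.card * (2 * 2 ^ (Fintype.card α - k)) := by
    have hdc : ∑ c, M c =
        ∑ A ∈ 𝓕, (univ.filter fun c : α → Bool => ∀ x ∈ A, ∀ y ∈ A, c x = c y).card := by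
      have := sum_card_bipartiteAbove_eq_sum_card_bipartiteBelow
        (s := (univ : Finset (α → Bool))) (t := 𝓕)
        (r := fun (c : α → Bool) (A : Finset α) => ∀ x ∈ A, ∀ y ∈ A, c x = c y)
      exact this
    rw [hdc]
    calc _ ≤ ∑ A ∈ 𝓕, 2 * 2 ^ (Fintype.card α - k) :=
          sum_le_sum fun A hA => by rw [← hk A hA]; exact card_colorings_monochromatic_le A
      _ = _ := by rw [sum_const, smul_eq_mul]
  by_contra! H
  have hlt : ∑ _c : α → Bool, 𝓕.card < ∑ c : α → Bool, 2 ^ (k - 1) * M c :=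
    sum_lt_sum_of_nonempty univ_nonempty fun c _ => H c
  rw [sum_const, smul_eq_mul, card_univ, Fintype.card_fun, Fintype.card_bool, ← mul_sum] at hlt
  have hle : 2 ^ (k - 1) * ∑ c, M c ≤ 2 ^ Fintype.card α * 𝓕.card :=
    calc 2 ^ (k - 1) * ∑ c, M c ≤ 2 ^ (k - 1) * (𝓕.card * (2 * 2 ^ (Fintype.card α - k))) :=
          Nat.mul_le_mul_left _ hsum
      _ = (2 ^ (k - 1) * (2 * 2 ^ (Fintype.card α - k))) * 𝓕.card := by ring
      _ = 2 ^ Fintype.card α * 𝓕.card := by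
          rw [← pow_succ', ← pow_add]
          congr 2
          omega
  exact absurd (hlt.trans_le hle) (lt_irrefl _)

end Counting

end Literature.Combinatorics.SetFamily
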